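import Summits.ResolutionOfSingularities.ResolutionOfSingularities.Theorems.FrobeniusClosingPatchingRelPerfectDepthMixedTargetsJR
import Summits.ResolutionOfSingularities.ResolutionOfSingularities.Theorems.FrobeniusClosingPatchingRelPerfectDepthMixedFormatB
import Summits.ResolutionOfSingularities.ResolutionOfSingularities.Theorems.FrobeniusClosingPatchingRelPerfectDepthBoundaryLiftPointwise
import Summits.ResolutionOfSingularities.ResolutionOfSingularities.Theorems.FrobeniusClosingPatchingRelPerfectDepthEndTwoMonomialGlue
import HarnessLib

/-!
# Crux `PatchingRelPerfect` (stmt-ResolutionOfSingularities-16161), chain W5.2 — TargetsF5 of record (JR, v5.1):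
# the two-monomial END `EndTwoMonomialJR ℓ MixedFormatB` — EVERY `ℓ` — BY NAME

[OURS · L1 W5.2 · rung R4ˢ-general] Replaces the role of NO printed item; NOT a statement of the manuscript under review;
fact-free. res-L1-w52-plan-1's target `DepthTargets.EndTwoMonomialJR ℓ P` (`…DepthMixedTargetsJR`, p515168) for res-D-pv-052's
instance `P = DepthGraded.MixedFormatB ℓ` (`…DepthMixedFormatB`, p514436): at a terminal state (`EndStateJR (K|_E) D ℬ`: the carried
reduced host `D` regular and `HasSNC (D :: boundaryOf ℬ)` on `E`) the X-side residual `K = 𝓐·monomialIdeal 𝒢 ⊔ monomialIdeal 𝒩·𝓘_E^ℓ`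
is a sum of two monomials in ONE family — `endFamily 𝓐 𝓘_E 𝒢 𝒩 = [𝓐, 𝓘_E] ++ (charged members)` (exponent-zero members out) —
simple normal crossings AT EVERY POINT of its cosupport. ASSEMBLY (`DepthSNC.exists_endTwoMonomial_of_halves`, p515561, res-D-pv-009)
of the two halves:
* ON `i(E)` — res-D-pv-052's E′-locus half: `DepthRetract.sncWithAt_host_cons` (…DepthBoundaryLiftPointwise) lifts the E-side snc of
  `D :: boundaryOf ℬ` (with `D ∉ boundaryOf ℬ`, from the format's «host has no boundary component») to `𝓐 :: 𝓘_E :: boundaryOf 𝒢`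
  at `i y`, using the format's global `HasSNC (𝓘_E :: boundaryOf 𝒢)`, the trace `𝓐|_E = D` and the alignment of `𝒢` with `ℬ`;
* OFF `i(E)` — res-D-pv-009's pocket half: the format's POCKET FIELD «`∀ x ∈ cosupp K ∖ i(E), SNCWithAt (𝓐 :: 𝓘_E :: charged 𝒢 𝒩) ⊤ x`»
  (propagated along the tower by `DepthSNC.pocketSNC_step[_host']`, fed by the JOINT clause, …DepthPocketInvariant{,Host}).

* `charged_eq` — `DepthGraded.charged 𝒢 𝒩` and the tail of `DepthSNC.endFamily` have the same members;
* `not_mem_boundaryOf_of_forall_not_le` — `(∀ p ∈ ℬ, ¬ D ≤ p.1) → D ∉ boundaryOf ℬ`;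
* **`endTwoMonomialJR_mixedFormatB : EndTwoMonomialJR ℓ MixedFormatB`** (every `ℓ`).

## References
* J. Kollár, *Lectures on Resolution of Singularities* (2007), (3.111) Step 3, Cor. 3.85. [Kollar2007]
* E. Bierstone, D. Grigoriev, P. Milman, J. Włodarczyk, arXiv:1206.3090, §4 Step 2b, Def. 3.1.3 (2). [BierstoneGrigorievMilmanWlodarczyk2011]
-/

-- `Summit.<Summit>.<Sub>.Theorems` with `Sub = Summit` (single-conjunct summit, D-0017)
set_option linter.dupNamespace false

noncomputable section

open CategoryTheory CategoryTheory.Limits AlgebraicGeometry TopologicalSpace IsLocalRing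
open Literature.AlgebraicGeometry.Resolution
open Scheme.IdealSheafData

namespace Summit.ResolutionOfSingularities.ResolutionOfSingularities.Theorems

universe u

namespace DepthSNC

variable {X : Scheme.{u}}

/-- The charged list of the format and the tail of the END family have the same members. [folklore] -/
theorem mem_charged_iff {𝒢 𝒩 : List (X.IdealSheafData × ℕ)} {G : X.IdealSheafData} :
    G ∈ DepthGraded.charged 𝒢 𝒩 ↔
      G ∈ boundaryOf (𝒢.filter fun p => decide (0 < p.2)) ++ boundaryOf (𝒩.filter fun p => decide (0 < p.2)) := by
  rw [DepthGraded.charged, List.filter_append, boundaryOf_append, List.mem_append, List.mem_append]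
  exact Or.comm

/-- Members of the END family belong to the format's family `𝓐 :: J :: charged 𝒢 𝒩`. [folklore] -/
theorem mem_cons_cons_charged_of_mem_endFamily {𝓐 J : X.IdealSheafData} {𝒢 𝒩 : List (X.IdealSheafData × ℕ)}
    {G : X.IdealSheafData} (hG : G ∈ endFamily 𝓐 J 𝒢 𝒩) : G ∈ 𝓐 :: J :: DepthGraded.charged 𝒢 𝒩 := by
  rw [endFamily, List.append_assoc, List.mem_append] at hG
  rcases hG with h | h
  · rcases List.mem_cons.mp h with rfl | h
    · exact List.mem_cons_self
    · rcases List.mem_cons.mp h with rfl | h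
      · exact List.mem_cons_of_mem _ List.mem_cons_self
      · simp at h
  · exact List.mem_cons_of_mem _ (List.mem_cons_of_mem _ (mem_charged_iff.mpr h))

/-- Members of the END family belong to the FULL family `𝓐 :: J :: boundaryOf 𝒢` when `boundaryOf 𝒩 ⊆ boundaryOf 𝒢`. [folklore] -/
theorem mem_cons_cons_boundaryOf_of_mem_endFamily {𝓐 J : X.IdealSheafData} {𝒢 𝒩 : List (X.IdealSheafData × ℕ)}
    (h𝒩 : ∀ G ∈ boundaryOf 𝒩, G ∈ boundaryOf 𝒢) {G : X.IdealSheafData} (hG : G ∈ endFamily 𝓐 J 𝒢 𝒩) :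
    G ∈ 𝓐 :: J :: boundaryOf 𝒢 := by
  rw [endFamily, List.append_assoc, List.mem_append] at hG
  rcases hG with h | h
  · rcases List.mem_cons.mp h with rfl | h
    · exact List.mem_cons_self
    · rcases List.mem_cons.mp h with rfl | h
      · exact List.mem_cons_of_mem _ List.mem_cons_self
      · simp at h
  · refine List.mem_cons_of_mem _ (List.mem_cons_of_mem _ ?_)
    rcases List.mem_append.mp h with h | h
    · obtain ⟨a, -, ha⟩ := mem_boundaryOf_of_mem_filter_pos h
      exact fst_mem_boundaryOf ha
    · obtain ⟨a, -, ha⟩ := mem_boundaryOf_of_mem_filter_pos h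
      exact h𝒩 G (fst_mem_boundaryOf ha)

/-- `D ∉ boundaryOf ℬ` from «`D` is contained in no boundary member». [folklore] -/
theorem not_mem_boundaryOf_of_forall_not_le {E : Scheme.{u}} {D : E.IdealSheafData} {ℬ : List (E.IdealSheafData × ℕ)}
    (h : ∀ p ∈ ℬ, ¬ D ≤ p.1) : D ∉ boundaryOf ℬ := by
  intro hD
  obtain ⟨a, ha⟩ := mem_boundaryOf_iff.mp hD
  exact h (D, a) ha le_rfl

end DepthSNC

namespace DepthGraded

/-- [OURS · L1 W5.2] **`EndTwoMonomialJR ℓ MixedFormatB` — the two-monomial END of TargetsF5 (JR), EVERY depth `ℓ`.** At a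
terminal state of the boundary-carrying format (`MixedFormatB ℓ i K N D ℬ 𝒟`) with `EndStateJR (K|_E) D ℬ`, the residual
`K = 𝓐·monomialIdeal 𝒢 ⊔ monomialIdeal 𝒩·𝓘_E^ℓ` is `⊤ · (monomialIdeal A ⊔ monomialIdeal B)` for `A = endListA 𝓐 𝓘_E 𝒢 𝒩`
(exponents `(1, 0, h, 0)`), `B = endListB ℓ 𝓐 𝓘_E 𝒢 𝒩` (exponents `(0, ℓ, 0, a)`) over ONE family `endFamily` (host, `𝓘_E`, charged
members), which is simple normal crossings at every cosupport point: ON `i(E)` by res-D-pv-052's lift `DepthRetract.sncWithAt_host_cons`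
of the E-side END `HasSNC (D :: boundaryOf ℬ)` together with the format's global `HasSNC (𝓘_E :: boundaryOf 𝒢)`; OFF `i(E)` by the
format's POCKET FIELD (res-D-pv-009). [cite: Kollar2007, (3.111) Step 3, Cor. 3.85] [cite: BierstoneGrigorievMilmanWlodarczyk2011, §4 Step 2b] -/
theorem endTwoMonomialJR_mixedFormatB (ℓ : ℕ) :
    DepthTargets.EndTwoMonomialJR ℓ
      (fun ⦃E X : Scheme.{u}⦄ (i : E ⟶ X) (K N : X.IdealSheafData) (D : E.IdealSheafData)
        (ℬ 𝒟 : List (E.IdealSheafData × ℕ)) => MixedFormatB ℓ i K N D ℬ 𝒟) := by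
  intro S _ _ I E X i g K N D ℬ 𝒟 hinv hP hEnd
  haveI := hinv.isNoetherian
  haveI := hinv.isClosedImmersion
  obtain ⟨𝓐, 𝒢, 𝒩, h𝓐, h𝒢c, h𝒢al, -, h𝒩𝒢, h𝓐D, hDℬ, hsnc, hK, -, -, -, hpocket⟩ := hP
  obtain ⟨-, hEsnc, -⟩ := hEnd
  refine DepthSNC.exists_endTwoMonomial_of_halves i hK ?_ hpocket ?_
  · -- ON `i(E)`: res-D-pv-052's retraction-free lift of the E-side END
    intro x hxK hxE
    obtain ⟨y, rfl⟩ := hxE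
    have hX : DepthSNC.SNCWithAt (i.ker :: boundaryOf 𝒢) ⊤ (i.base y) := hsnc.sncWithAt _
    have hE : DepthSNC.SNCWithAt (D :: boundaryOf ℬ) ⊤ y := hEsnc.sncWithAt _
    have hlift := DepthRetract.sncWithAt_host_cons i hinv.isEffectiveCartier_ker y h𝓐 h𝓐D h𝒢c
      (MixedFormatB.map_comap_boundaryOf h𝒢al) (DepthSNC.not_mem_boundaryOf_of_forall_not_le hDℬ) hX hE
    exact hlift.top.anti fun G hG _ => DepthSNC.mem_cons_cons_boundaryOf_of_mem_endFamily h𝒩𝒢 hG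
  · -- OFF `i(E)`: the END family is a sub-family of the pocket field's family
    intro G hG _ _ _
    exact DepthSNC.mem_cons_cons_charged_of_mem_endFamily hG

end DepthGraded

end Summit.ResolutionOfSingularities.ResolutionOfSingularities.Theorems

end
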